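import Summits.HodgeConjecture.CorCM.GaloisOddMetacyclicCertificates
import Summits.HodgeConjecture.CorCM.GaloisAllTypesEngine
import Summits.HodgeConjecture.CorCM.CyclicTwoPowerCMTypes
import HarnessLib

/-!
# Galois CM fields with group `C_p ⋊_r C_{2^{k+1}}` (unique involution): if every PRIMITIVE CM type is nondegenerate then EVERY
# abelian variety with complex multiplication by the field is STABLY NONDEGENERATE

COR-CM (cell `pub-hodgecm2`), binder seat b04 (gen 26), count-neutral claim CYCLIC-SEMIDIRECT-RESIDUE, part V♯a — the ALL-TYPES
reduction (gen 21 ENGINE `GaloisRank.isStablyNondegenerate_of_forall_admissible'`) for the whole metacyclic family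
`G₀ = C_p ⋊_r C_{2^{k+1}} = Multiplicative (ZMod p) ⋊[φ] Multiplicative (ZMod (2^(k+1)))`, `φ(1) = (·)^r`, `r^{2^k} ≡ 1 (mod p)`
(`p` an odd prime; complex conjugation `c₀ = y^{2^k}` is the UNIQUE involution, `CorCM/GaloisOddMetacyclicCertificates`).
GROUP THEORY (§1): an ADMISSIBLE STABILISER `v` (`v ≠ 1`, `c₀ ∉ ⟨v⟩`) has odd order (a cyclic group of even order contains the
unique involution), so `v ∈ C_p`, `⟨v⟩ = C_p = ker(G₀ → C_{2^{k+1}})` is normal and `G₀ ⧸ ⟨v⟩ ≅ C_{2^{k+1}}` is CYCLIC.  Hence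
(§2) an imprimitive type is induced from the fixed field `K₀ = K^{C_p}`, a cyclic CM field of degree `2^{k+1}`, ALL of whose CM
types are nondegenerate (gen 11 `CyclicTwoPower.isNondegenerate_of_isCyclic`), and the engine yields: **if every primitive CM type
of `K` is nondegenerate then every complex abelian variety `X` with `K ↪ End⁰(X)`, `[K:ℚ] = 2 dim X`, is stably nondegenerate.**
The hypothesis holds for the inversion action under `2^{a+2} ∤ p − 1 ∧ 2^{a+1} ∤ p + 1` (`CorCM/GaloisCyclicSemidirectTwoPower
{Residue,AllTypes}`); for actions of order `2^j ≥ 4` it is the cyclic-algebra question of the gen-26 FRONTIER.  KERNEL ONLY: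
theorems; no definition, no named fact, no `sorry`.  `HC_CM` is neither used nor claimed.

* §1 `eq_inl_of_not_mem_zpowers`, `orderOf_inl_eq`, `zpowers_inl_eq_ker`, `phi_one_eq_pow_of_inv`, `pred_pow_two_pow_mod`.
* §2 **`isStablyNondegenerate_of_ringHom_metacyclic`**.

## References

* [Shimura1998] G. Shimura, *Abelian Varieties with Complex Multiplication and Modular Functions* (1998), §5.1 Prop. 3,
  §8.2 Prop. 26.
* [Gordon1999HodgeAVSurvey] B. B. Gordon, *A survey of the Hodge conjecture for abelian varieties*, Thm. 6.4, Def. 7.6.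
* [Kubota1965] T. Kubota, Trans. AMS 118 (1965), §4 Lemma 2.
* [Dodson1984] B. Dodson, *The structure of Galois groups of CM-fields*, Trans. AMS 283 (1984), Prop. 5.2.2, §5.3.
-/

noncomputable section

open CategoryTheory CategoryTheory.Limits NumberField

namespace Summit.HodgeConjecture.CorCM.GaloisOddMetacyclic

open Literature.NumberTheory.ComplexMultiplication
open Literature.AlgebraicGeometry Literature.AlgebraicGeometry.Motives Literature.AlgebraicGeometry.HodgeTheory
open Literature.AlgebraicGeometry.Motives.AbelianVariety
open Literature.AlgebraicGeometry.ComplexMultiplication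
open Literature.AlgebraicGeometry.Pohlmann1968
open Summit.HodgeConjecture.CorCM.GaloisRank

/-! ## §1 Group theory: the admissible stabilisers of `C_p ⋊_r C_{2^{k+1}}` lie in `C_p` -/

section Group

variable {p k : ℕ} (r : ℕ)
variable (φ : Multiplicative (ZMod (2 ^ (k + 1))) →* MulAut (Multiplicative (ZMod p)))
  (hφ : ∀ v : Multiplicative (ZMod p), φ (Multiplicative.ofAdd 1) v = v ^ r)

include hφ in
/-- **An element whose cyclic group avoids the involution lies in `C_p`.**  In `C_p ⋊_r C_{2^{k+1}}` (`p` odd) a `v` with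
`c₀ = y^{2^k} ∉ ⟨v⟩` has odd order (an element of even order has the unique involution among its powers), so its image
in `C_{2^{k+1}}` is trivial: `v = inl (v.left)`. [folklore] -/
theorem eq_inl_of_not_mem_zpowers (hp : p.Prime) (hp2 : p ≠ 2) (hr : r ^ 2 ^ k % p = 1)
    (v : Multiplicative (ZMod p) ⋊[φ] Multiplicative (ZMod (2 ^ (k + 1))))
    (hv : (SemidirectProduct.inr (Multiplicative.ofAdd ((2 ^ k : ℕ) : ZMod (2 ^ (k + 1)))) :
      Multiplicative (ZMod p) ⋊[φ] Multiplicative (ZMod (2 ^ (k + 1)))) ∉ Subgroup.zpowers v) :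
    v = SemidirectProduct.inl v.left := by
  classical
  haveI : Fact p.Prime := ⟨hp⟩
  haveI : NeZero (2 ^ (k + 1)) := ⟨by positivity⟩
  haveI : Fintype (Multiplicative (ZMod p) ⋊[φ] Multiplicative (ZMod (2 ^ (k + 1)))) :=
    Fintype.ofEquiv _ SemidirectProduct.equivProd.symm
  -- the order of `v` is odd
  have hodd : Odd (orderOf v) := by
    by_contra hev
    rw [Nat.not_odd_iff_even] at hev
    obtain ⟨m, hm⟩ := hev
    have hm0 : 0 < m := by have := orderOf_pos v; omega
    have hw1 : v ^ m ≠ 1 := pow_ne_one_of_lt_orderOf hm0.ne' (by omega)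
    have hww : v ^ m * v ^ m = 1 := by rw [← pow_add, ← hm, pow_orderOf_eq_one]
    have hw := involution_eq r φ hφ hp hp2 hr (v ^ m) hww hw1
    exact hv (hw ▸ Subgroup.npow_mem_zpowers v m)
  -- its image in `C_{2^{k+1}}` has odd order dividing `2^{k+1}`, hence is trivial
  have h1 : SemidirectProduct.rightHom v = 1 := by
    have hdvd1 : orderOf (SemidirectProduct.rightHom v) ∣ orderOf v := orderOf_map_dvd _ v
    have hdvd2 : orderOf (SemidirectProduct.rightHom v) ∣ 2 ^ (k + 1) := by
      have h := orderOf_dvd_card (x := SemidirectProduct.rightHom v)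
      rwa [Fintype.card_multiplicative, ZMod.card] at h
    have hodd' : Odd (orderOf (SemidirectProduct.rightHom v)) := hodd.of_dvd_nat hdvd1
    obtain ⟨j, -, hj⟩ := (Nat.dvd_prime_pow Nat.prime_two).1 hdvd2
    rw [hj] at hodd'
    have hj0 : j = 0 := by
      by_contra hj0
      exact (Nat.not_even_iff_odd.2 hodd') (Nat.even_pow.2 ⟨even_two, hj0⟩)
    rw [hj0, pow_zero] at hj
    exact orderOf_eq_one_iff.1 hj
  have h2 : v.right = 1 := by
    have h := h1
    rwa [SemidirectProduct.rightHom_eq_right] at h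
  calc v = SemidirectProduct.inl v.left * SemidirectProduct.inr v.right := (SemidirectProduct.inl_left_mul_inr_right v).symm
    _ = SemidirectProduct.inl v.left := by rw [h2, map_one, mul_one]

/-- `inl u` has order `p` for `u ≠ 1`. [folklore] -/
theorem orderOf_inl_eq (hp : p.Prime) (u : Multiplicative (ZMod p)) (hu : u ≠ 1) :
    orderOf (SemidirectProduct.inl u : Multiplicative (ZMod p) ⋊[φ] Multiplicative (ZMod (2 ^ (k + 1)))) = p := by
  haveI : Fact p.Prime := ⟨hp⟩
  rw [orderOf_injective SemidirectProduct.inl SemidirectProduct.inl_injective u]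
  refine orderOf_eq_prime ?_ hu
  have h := pow_card_eq_one (x := u)
  rwa [Fintype.card_multiplicative, ZMod.card] at h

/-- **`⟨inl u⟩ = C_p = ker(G₀ → C_{2^{k+1}})`** for `u ≠ 1` (`C_p` has prime order). [folklore] -/
theorem zpowers_inl_eq_ker (hp : p.Prime) (u : Multiplicative (ZMod p)) (hu : u ≠ 1) :
    Subgroup.zpowers (SemidirectProduct.inl u : Multiplicative (ZMod p) ⋊[φ] Multiplicative (ZMod (2 ^ (k + 1)))) =
      (SemidirectProduct.rightHom (N := Multiplicative (ZMod p)) (G := Multiplicative (ZMod (2 ^ (k + 1))))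
        (φ := φ)).ker := by
  haveI : Fact p.Prime := ⟨hp⟩
  apply le_antisymm
  · rw [Subgroup.zpowers_le, MonoidHom.mem_ker, SemidirectProduct.rightHom_inl]
  · intro w hw
    rw [MonoidHom.mem_ker] at hw
    have hw' : w = SemidirectProduct.inl w.left := by
      have h2 : w.right = 1 := by
        have h := hw
        rwa [SemidirectProduct.rightHom_eq_right] at h
      calc w = SemidirectProduct.inl w.left * SemidirectProduct.inr w.right :=
            (SemidirectProduct.inl_left_mul_inr_right w).symm
        _ = SemidirectProduct.inl w.left := by rw [h2, map_one, mul_one]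
    -- `u` generates `C_p`
    have hup : u ^ p = 1 := by
      have h := pow_card_eq_one (x := u)
      rwa [Fintype.card_multiplicative, ZMod.card] at h
    have htop : Subgroup.zpowers u = ⊤ := by
      apply Subgroup.eq_top_of_card_eq
      rw [Nat.card_zpowers, orderOf_eq_prime hup hu, Nat.card_eq_fintype_card, Fintype.card_multiplicative, ZMod.card]
    have hgen : w.left ∈ Subgroup.zpowers u := by rw [htop]; exact Subgroup.mem_top _
    obtain ⟨k, hk⟩ := Subgroup.mem_zpowers_iff.1 hgen
    rw [hw', ← hk, map_zpow]
    exact Subgroup.zpow_mem_zpowers _ _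

/-- The inversion action as a power: `φ(1) = (·)⁻¹ ⟹ φ(1) = (·)^{p−1}`. [folklore] -/
theorem phi_one_eq_pow_of_inv {m : ℕ} (hp : p.Prime)
    (φ : Multiplicative (ZMod m) →* MulAut (Multiplicative (ZMod p)))
    (hφ : ∀ v : Multiplicative (ZMod p), φ (Multiplicative.ofAdd 1) v = v⁻¹) (v : Multiplicative (ZMod p)) :
    φ (Multiplicative.ofAdd 1) v = v ^ (p - 1) := by
  haveI : Fact p.Prime := ⟨hp⟩
  rw [hφ]
  have hvp : v ^ p = 1 := by
    have h := pow_card_eq_one (x := v)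
    rwa [Fintype.card_multiplicative, ZMod.card] at h
  refine (eq_inv_of_mul_eq_one_left ?_).symm
  rw [← pow_succ, Nat.sub_add_cancel hp.one_le, hvp]

/-- `(p − 1)^{2^{a+1}} ≡ 1 (mod p)`. [folklore] -/
theorem pred_pow_two_pow_mod {a : ℕ} (hp : p.Prime) : (p - 1) ^ 2 ^ (a + 1) % p = 1 := by
  have h2 := hp.two_le
  have hsq : (p - 1) ^ 2 = p * (p - 2) + 1 := by
    zify [show 1 ≤ p by omega, show 2 ≤ p by omega]; ring
  rw [pow_succ', pow_mul, hsq, Nat.pow_mod, Nat.mul_add_mod, Nat.mod_eq_of_lt hp.one_lt, one_pow,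
    Nat.mod_eq_of_lt hp.one_lt]

end Group

/-! ## §2 Every abelian variety with a `K`-action is stably nondegenerate -/

section Field

variable {p k : ℕ} (r : ℕ) [Fact p.Prime]
variable {K : Type} [Field K] [NumberField K] [IsCMField K] [IsGalois ℚ K]

/-- **THEOREM (ALL TYPES, conditional form).  `K` Galois CM with `Gal(K/ℚ) ≅ C_p ⋊_r C_{2^{k+1}}` (`p` odd,
`φ(1) = (·)^r`, `r^{2^k} ≡ 1 (mod p)`) such that every PRIMITIVE CM type of `K` is nondegenerate.  Then EVERY complex abelian variety `X` with
`ψ : K →+* End⁰(X)` and `[K:ℚ] = 2 dim X` is STABLY NONDEGENERATE** (the imprimitive types are induced from the cyclic CM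
field `K^{C_p}` of degree `2^{k+1}`, all of whose types are nondegenerate). [cite: Shimura1998, §5.1 Prop. 3, §8.2 Prop. 26]
[cite: Gordon1999HodgeAVSurvey, Thm. 6.4 and Def. 7.6] [cite: Kubota1965, §4 Lemma 2] -/
theorem isStablyNondegenerate_of_ringHom_metacyclic (hp2 : p ≠ 2) (hr : r ^ 2 ^ k % p = 1)
    (φ : Multiplicative (ZMod (2 ^ (k + 1))) →* MulAut (Multiplicative (ZMod p)))
    (hφ : ∀ v : Multiplicative (ZMod p), φ (Multiplicative.ofAdd 1) v = v ^ r)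
    (e : (K ≃ₐ[ℚ] K) ≃* Multiplicative (ZMod p) ⋊[φ] Multiplicative (ZMod (2 ^ (k + 1))))
    (hprim : ∀ (Φ : CMType K) (φ₀ : K →+* ℂ), IsPrimitive (ℂ ≃+* ℂ) Φ.1 φ₀ → IsNondegenerate Φ)
    {X : AbelianVariety ℂ} (ψ : K →+* X.endAlgebra) (hX : Module.finrank ℚ K = 2 * X.dim) :
    IsStablyNondegenerate X := by
  classical
  have hp : p.Prime := Fact.out
  haveI : NeZero p := ⟨hp.ne_zero⟩
  haveI : NeZero (2 ^ (k + 1)) := ⟨by positivity⟩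
  haveI : Fintype (Multiplicative (ZMod p) ⋊[φ] Multiplicative (ZMod (2 ^ (k + 1)))) :=
    Fintype.ofEquiv _ SemidirectProduct.equivProd.symm
  have hc := map_complexConj_eq r φ hφ hp hp2 hr e
  refine isStablyNondegenerate_of_forall_admissible' e hc hprim (fun v hv1 hcv Φ₀ => ?_) ψ hX
  -- `v = inl u`, `u ≠ 1`, `⟨v⟩ = C_p` normal, quotient `C_{2^{k+1}}`
  have hv := eq_inl_of_not_mem_zpowers r φ hφ hp hp2 hr v hcv
  have hu : v.left ≠ 1 := fun h => hv1 (by rw [hv, h, map_one])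
  have hker : Subgroup.zpowers v = (SemidirectProduct.rightHom (N := Multiplicative (ZMod p))
      (G := Multiplicative (ZMod (2 ^ (k + 1)))) (φ := φ)).ker := by
    rw [hv]; exact zpowers_inl_eq_ker φ hp v.left hu
  haveI hN : (Subgroup.zpowers v).Normal := by rw [hker]; exact MonoidHom.normal_ker _
  haveI : IsCMField (IntermediateField.fixedField ((Subgroup.zpowers v).comap
      (e : (K ≃ₐ[ℚ] K) →* Multiplicative (ZMod p) ⋊[φ] Multiplicative (ZMod (2 ^ (k + 1)))))) :=
    isCMField_fixedField_of_not_mem _ fun h => hcv (hc ▸ Subgroup.mem_comap.1 h)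
  haveI : IsGalois ℚ (IntermediateField.fixedField ((Subgroup.zpowers v).comap
      (e : (K ≃ₐ[ℚ] K) →* Multiplicative (ZMod p) ⋊[φ] Multiplicative (ZMod (2 ^ (k + 1)))))) :=
    isGalois_fixedField_comap_zpowers e v
  obtain ⟨e₀⟩ := exists_mulEquiv_fixedField_quotient e v
  have e₁ : (Multiplicative (ZMod p) ⋊[φ] Multiplicative (ZMod (2 ^ (k + 1)))) ⧸ Subgroup.zpowers v ≃*
      Multiplicative (ZMod (2 ^ (k + 1))) :=
    (QuotientGroup.quotientMulEquivOfEq hker).trans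
      (QuotientGroup.quotientKerEquivOfSurjective _ SemidirectProduct.rightHom_surjective)
  have hcyc : IsCyclic ((IntermediateField.fixedField ((Subgroup.zpowers v).comap
      (e : (K ≃ₐ[ℚ] K) →* Multiplicative (ZMod p) ⋊[φ] Multiplicative (ZMod (2 ^ (k + 1)))))) ≃ₐ[ℚ]
      (IntermediateField.fixedField ((Subgroup.zpowers v).comap
      (e : (K ≃ₐ[ℚ] K) →* Multiplicative (ZMod p) ⋊[φ] Multiplicative (ZMod (2 ^ (k + 1))))))) :=
    isCyclic_of_surjective ((e₀.trans e₁).symm : Multiplicative (ZMod (2 ^ (k + 1))) →* _) (e₀.trans e₁).symm.surjective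
  have hov : orderOf v = p := by rw [hv]; exact orderOf_inl_eq φ hp v.left hu
  have hdeg : Module.finrank ℚ (IntermediateField.fixedField ((Subgroup.zpowers v).comap
      (e : (K ≃ₐ[ℚ] K) →* Multiplicative (ZMod p) ⋊[φ] Multiplicative (ZMod (2 ^ (k + 1)))))) = 2 ^ (k + 1) := by
    have h := finrank_fixedField_comap_zpowers e v
    rw [finrank_eq φ hp e, hov] at h
    exact Nat.eq_of_mul_eq_mul_right hp.pos h
  exact CyclicTwoPower.isNondegenerate_of_isCyclic hcyc (k := k) hdeg Φ₀

end Field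

end Summit.HodgeConjecture.CorCM.GaloisOddMetacyclic

end
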